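import Mathlib
import HarnessLib

/-!
# Route `EightfoldBlochSeeds`, cruxes `BlochSeedsGeneric` / `BlochSeedDiscThree` (items stmt-HodgeConjecture-18880 / 18882),
# stub `stub_pad4_carrier`: the SPREADING step of «smooth ⊂ smooth ⟹ regular immersion» (brick K5-d of the one named fact
# `kleiman1969_smoothingCycles_eightfold_codimFour` the stub is closed modulo) — regularity of an element / a sequence on a
# finitely generated module at a prime `𝔭` spreads to a basic open `D(g)`, `g ∉ 𝔭`

HONEST FRAMING. Pure commutative algebra (Mathlib only), `--supports` helper; nothing here proves the stub, (K), the crux,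
H2, HC_AV or HC. No definition, no named fact (D-0026).

WHY (repair census of this hand, NOTES.md `## Census`): the carrier stubs of 18880/18882 are closed modulo (K)
(`Theorems/EightfoldBlochSeedsBlochSeedsGenericPad4CarrierStubOfKleimanSmoothing`, p821723); (K)'s clause
`IsRegularImmersionOfCodim i 4` for Kleiman's smooth connected degeneracy locus `D` (of `r - 3` general sections of a rank-`r`
bundle, `r ≤ 8`: a DETERMINANTAL locus, lci only because it is smooth) needs EGA IV 17.12.1 «a closed subscheme smooth over
`k` of a scheme smooth over `k` is a regular immersion». The tree holds the point-level half (Matsumura 14.2: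
`Literature.AlgebraicGeometry.Resolution.exists_isRsopPart_fin_span_range_eq_stalkIdeal`, with
`Resolution.isRegularLocalRing_stalk_of_smooth_of_field`); the tree's `IsRegularImmersionOfCodim` (Görtz–Wedhorn Def. 19.19)
asks for a weakly regular generating sequence on an AFFINE OPEN, i.e. the regular sequence at the stalk `𝒪_{X,x} = A_𝔭`
must be spread to `Γ(X, D(g)) = A_g`. This file is that spreading, for modules:

* `isSMulRegular_localizedModule_of_forall_smul_eq_zero` — if every `m ∈ M` with `r • m = 0` is killed by an element of
  `S`, then `r` is `M_S`-regular;
* `exists_forall_smul_eq_zero_of_isSMulRegular_localizedModule` — for `M` Noetherian over `A` and `𝔭` prime: if `r` is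
  regular on `M_𝔭` then ONE `g ∉ 𝔭` kills every `m` with `r • m = 0` (the kernel of `r •` is finitely generated and dies
  at `𝔭`);
* `isSMulRegular_localizedModule_of_dvd`, `exists_isSMulRegular_localizedModule_powers` — hence `r` is regular on `M_S`
  for every `S` containing a multiple of some `g ∉ 𝔭`, in particular on `M_g = M[1/g]`;
* `nonempty_quotSMulTop_localizedModule_linearEquiv` — `M_S ⧸ r M_S ≃ (M ⧸ r M)_S` (Mathlib's `localizedQuotientEquiv`);
* `isWeaklyRegular_localizedModule_of_dvd`, `exists_isWeaklyRegular_localizedModule_powers` — the SEQUENCE form: a weakly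
  `M_𝔭`-regular `rs` is weakly `M_S`-regular for every `S` containing a multiple of some `g ∉ 𝔭` (induction through
  `M ⧸ r M`), in particular on `M_g` — with `M = A = Γ(X, U)` this is exactly the passage from `𝒪_{X,x}` to an affine
  `D(g) ∋ x` that `IsRegularImmersionOfCodim` requires.

[cite: Matsumura1987, §6 Thm. 6.1 and §16 (regular sequences; localisation)] [cite: GortzWedhorn2023, Def. 19.19]
[cite: EGAIV4, Prop. 17.12.1]
-/

-- single-problem summit (Problem = Summit): the mandated namespace repeats `HodgeConjecture`.
set_option linter.dupNamespace false

namespace Summit.HodgeConjecture.HodgeConjecture.Theorems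

open scoped Pointwise

variable {A : Type*} [CommRing A] {M : Type*} [AddCommGroup M] [Module A M]

/-- **Regularity on a localisation from a killing element.** If every `m ∈ M` with `r • m = 0` is annihilated by some
element of the submonoid `S`, then `r` is a non-zero-divisor on the localised module `M_S`: for `x = m/s` with
`r • x = 0` some `u ∈ S` has `r • (u • m) = 0`, so `v • u • m = 0` for some `v ∈ S` and `x = 0`.
[cite: Matsumura1987, §4 (localisation of modules) and §6 Thm. 6.1] -/
theorem isSMulRegular_localizedModule_of_forall_smul_eq_zero (S : Submonoid A) (r : A)
    (h : ∀ m : M, r • m = 0 → ∃ u ∈ S, u • m = 0) :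
    IsSMulRegular (LocalizedModule S M) r := by
  intro x y hxy
  rw [← sub_eq_zero] at hxy ⊢
  have hz : r • (x - y) = 0 := by
    rw [smul_sub]
    exact hxy
  induction' hxy' : x - y using LocalizedModule.induction_on with m s
  · rw [hxy'] at hz
    rw [LocalizedModule.smul'_mk, ← LocalizedModule.zero_mk s, LocalizedModule.mk_eq] at hz
    obtain ⟨u, hu⟩ := hz
    simp only [smul_zero, Submonoid.smul_def] at hu
    -- `hu : ↑u • ↑s • r • m = 0`
    have hrm : r • ((u : A) • (s : A) • m) = 0 := by
      rw [smul_comm r (u : A), smul_comm r (s : A)]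
      exact hu
    obtain ⟨v, hvS, hv⟩ := h _ hrm
    rw [← LocalizedModule.zero_mk s, LocalizedModule.mk_eq]
    refine ⟨⟨v * u, S.mul_mem hvS u.2⟩, ?_⟩
    simp only [smul_zero, Submonoid.mk_smul]
    rw [mul_smul]
    exact hv

/-- **One element outside `𝔭` kills the whole `r`-torsion** when `r` is regular on `M_𝔭` and `M` is Noetherian: the
kernel `K` of `m ↦ r • m` is finitely generated, each generator `t` maps to `0` in `M_𝔭` (as `r • (t/1) = 0`), i.e. is
killed by some `u_t ∉ 𝔭`, and `g = ∏ u_t ∉ 𝔭` (`𝔭` prime) kills `K`.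
[cite: Matsumura1987, §6 Thm. 6.1 (finitely many associated primes) — elementary form] -/
theorem exists_forall_smul_eq_zero_of_isSMulRegular_localizedModule [IsNoetherian A M]
    (p : Ideal A) [p.IsPrime] (r : A) (h : IsSMulRegular (LocalizedModule p.primeCompl M) r) :
    ∃ g ∉ p, ∀ m : M, r • m = 0 → g • m = 0 := by
  classical
  set K : Submodule A M := LinearMap.ker (LinearMap.lsmul A M r) with hKdef
  have hmemK : ∀ m : M, m ∈ K ↔ r • m = 0 := fun m => by
    rw [hKdef, LinearMap.mem_ker, LinearMap.lsmul_apply]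
  -- every element of `K` is killed by an element outside `p`
  have hkill : ∀ m ∈ K, ∃ u ∈ p.primeCompl, u • m = 0 := by
    intro m hm
    have hrm : r • m = 0 := (hmemK m).1 hm
    have h0 : (LocalizedModule.mk m 1 : LocalizedModule p.primeCompl M) = 0 := by
      apply h
      change r • LocalizedModule.mk m 1 = r • (0 : LocalizedModule p.primeCompl M)
      rw [LocalizedModule.smul'_mk, hrm, LocalizedModule.zero_mk, smul_zero]
    rw [← LocalizedModule.zero_mk 1, LocalizedModule.mk_eq] at h0
    obtain ⟨u, hu⟩ := h0
    refine ⟨u, u.2, ?_⟩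
    simpa [Submonoid.smul_def] using hu
  choose! u huS hu using hkill
  obtain ⟨T, hT⟩ := (IsNoetherian.noetherian K : K.FG)
  have hTK : ∀ t ∈ T, t ∈ K := fun t ht => hT ▸ Submodule.subset_span ht
  refine ⟨∏ t ∈ T, u t, ?_, ?_⟩
  · -- the product lies outside the prime `p`
    intro hmem
    obtain ⟨t, htT, htp⟩ := (Ideal.IsPrime.prod_mem_iff (p := p)).1 hmem
    exact huS t (hTK t htT) htp
  · intro m hm
    have hmK : m ∈ Submodule.span A (T : Set M) := hT ▸ (hmemK m).2 hm
    refine Submodule.span_induction ?_ ?_ ?_ ?_ hmK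
    · intro t ht
      rw [← Finset.prod_erase_mul T u ht, mul_smul, hu t (hTK t ht), smul_zero]
    · exact smul_zero _
    · intro x y _ _ hx hy
      rw [smul_add, hx, hy, add_zero]
    · intro a x _ hx
      rw [smul_comm, hx, smul_zero]

/-- **Regularity at a prime spreads to every localisation inverting a multiple of one `g ∉ 𝔭`.** For `M` Noetherian
over `A`, `𝔭` prime and `r` regular on `M_𝔭`, there is `g ∉ 𝔭` such that `r` is regular on `M_S` for every submonoid `S`
containing a multiple of `g` — in particular on `M_g` and on every `M_{gg'}` (the form needed to intersect finitely many
basic opens). [cite: Matsumura1987, §6 Thm. 6.1 and §16] [cite: EGAIV4, Prop. 17.12.1 (its use: spreading regular sequences)] -/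
theorem isSMulRegular_localizedModule_of_dvd [IsNoetherian A M] (p : Ideal A) [p.IsPrime] (r : A)
    (h : IsSMulRegular (LocalizedModule p.primeCompl M) r) :
    ∃ g ∉ p, ∀ S : Submonoid A, ∀ s ∈ S, g ∣ s → IsSMulRegular (LocalizedModule S M) r := by
  obtain ⟨g, hgp, hg⟩ := exists_forall_smul_eq_zero_of_isSMulRegular_localizedModule p r h
  refine ⟨g, hgp, fun S s hsS hgs =>
    isSMulRegular_localizedModule_of_forall_smul_eq_zero S r fun m hm => ⟨s, hsS, ?_⟩⟩
  obtain ⟨t, rfl⟩ := hgs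
  rw [mul_comm, mul_smul, hg m hm, smul_zero]

/-- **The basic-open form**: `r` regular on `M_𝔭` ⟹ `r` regular on `M_g = M[1/g]` for some `g ∉ 𝔭`.
[cite: Matsumura1987, §6 Thm. 6.1 and §16] -/
theorem exists_isSMulRegular_localizedModule_powers [IsNoetherian A M] (p : Ideal A) [p.IsPrime] (r : A)
    (h : IsSMulRegular (LocalizedModule p.primeCompl M) r) :
    ∃ g ∉ p, IsSMulRegular (LocalizedModule (Submonoid.powers g) M) r := by
  obtain ⟨g, hgp, hg⟩ := isSMulRegular_localizedModule_of_dvd p r h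
  exact ⟨g, hgp, hg _ g (Submonoid.mem_powers g) dvd_rfl⟩

/-- **Localisation commutes with `M ↦ M ⧸ rM`**: `M_S ⧸ r·M_S ≃ (M ⧸ rM)_S` as `A`-modules (Mathlib's
`localizedQuotientEquiv` for the submodule `r • ⊤`, whose localisation is `r • ⊤` by `Submodule.localized₀_smul`).
[cite: Matsumura1987, §4 Thm. 4.4 (localisation is exact)] -/
theorem nonempty_quotSMulTop_localizedModule_linearEquiv (S : Submonoid A) (r : A) :
    Nonempty (QuotSMulTop r (LocalizedModule S M) ≃ₗ[A] LocalizedModule S (QuotSMulTop r M)) := by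
  have heq : (r • ⊤ : Submodule A (LocalizedModule S M)) =
      ((r • ⊤ : Submodule A M).localized S).restrictScalars A := by
    change _ = (r • ⊤ : Submodule A M).localized₀ S (LocalizedModule.mkLinearMap S M)
    rw [← Submodule.ideal_span_singleton_smul r (⊤ : Submodule A M), Submodule.localized₀_smul,
      Submodule.localized₀_top, Submodule.ideal_span_singleton_smul]
  exact ⟨(Submodule.quotEquivOfEq _ _ heq).trans
    ((Submodule.Quotient.restrictScalarsEquiv A ((r • ⊤ : Submodule A M).localized S)).trans
      ((localizedQuotientEquiv S (r • ⊤ : Submodule A M)).restrictScalars A))⟩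

open RingTheory.Sequence in
/-- **A weakly regular sequence at a prime spreads to a basic open** (the commutative algebra of EGA IV 17.12.1's use in
«smooth ⊂ smooth ⟹ regular immersion»): for `M` Noetherian over `A` and `𝔭` prime, if `rs` is weakly `M_𝔭`-regular then
there is `g ∉ 𝔭` with `rs` weakly `M_S`-regular for every submonoid `S` containing a multiple of `g` (so on `M_g`, and on
any finite intersection of such basic opens). Induction on `rs` through `M ⧸ r M` (Noetherian), using
`isSMulRegular_localizedModule_of_dvd` and `M_S ⧸ r M_S ≃ (M ⧸ r M)_S`. [cite: Matsumura1987, §16 Thm. 16.1 ff.]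
[cite: EGAIV4, Prop. 17.12.1] [cite: GortzWedhorn2023, Def. 19.19] -/
theorem isWeaklyRegular_localizedModule_of_dvd (rs : List A) :
    ∀ {N : Type*} [AddCommGroup N] [Module A N] [IsNoetherian A N] (p : Ideal A) [p.IsPrime],
      IsWeaklyRegular (LocalizedModule p.primeCompl N) rs →
      ∃ g ∉ p, ∀ S : Submonoid A, ∀ s ∈ S, g ∣ s → IsWeaklyRegular (LocalizedModule S N) rs := by
  induction rs with
  | nil =>
    intro N _ _ _ p _ _
    exact ⟨1, (Ideal.ne_top_iff_one p).1 Ideal.IsPrime.ne_top', fun S _ _ _ => IsWeaklyRegular.nil A _⟩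
  | cons r rs ih =>
    intro N _ _ _ p _ h
    obtain ⟨h1, h2⟩ := (isWeaklyRegular_cons_iff (LocalizedModule p.primeCompl N) r rs).1 h
    obtain ⟨g₁, hg₁p, hg₁⟩ := isSMulRegular_localizedModule_of_dvd p r h1
    obtain ⟨e⟩ := nonempty_quotSMulTop_localizedModule_linearEquiv (M := N) p.primeCompl r
    obtain ⟨g₂, hg₂p, hg₂⟩ := ih (N := QuotSMulTop r N) p ((e.isWeaklyRegular_congr rs).1 h2)
    refine ⟨g₁ * g₂, fun hmem => (Ideal.IsPrime.mem_or_mem ‹p.IsPrime› hmem).elim hg₁p hg₂p, ?_⟩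
    intro S s hsS hgs
    obtain ⟨eS⟩ := nonempty_quotSMulTop_localizedModule_linearEquiv (M := N) S r
    exact (isWeaklyRegular_cons_iff (LocalizedModule S N) r rs).2
      ⟨hg₁ S s hsS (dvd_trans (dvd_mul_right g₁ g₂) hgs),
        (eS.isWeaklyRegular_congr rs).2 (hg₂ S s hsS (dvd_trans (dvd_mul_left g₂ g₁) hgs))⟩

open RingTheory.Sequence in
/-- **The basic-open form for sequences**: `rs` weakly regular on `M_𝔭` ⟹ weakly regular on `M_g` for some `g ∉ 𝔭`.
[cite: Matsumura1987, §16] [cite: EGAIV4, Prop. 17.12.1] -/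
theorem exists_isWeaklyRegular_localizedModule_powers [IsNoetherian A M] (p : Ideal A) [p.IsPrime]
    (rs : List A) (h : IsWeaklyRegular (LocalizedModule p.primeCompl M) rs) :
    ∃ g ∉ p, IsWeaklyRegular (LocalizedModule (Submonoid.powers g) M) rs := by
  obtain ⟨g, hgp, hg⟩ := isWeaklyRegular_localizedModule_of_dvd rs p h
  exact ⟨g, hgp, hg _ g (Submonoid.mem_powers g) dvd_rfl⟩

/-! ## Ring form: from `A_𝔭` to `A_g` (the shape `IsRegularImmersionOfCodim` consumes, `Γ(X, D(g)) ≅ A_g`) -/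

section Ring

universe u

open RingTheory.Sequence in
/-- **A sequence of elements of a Noetherian ring `A` which is weakly regular in `A_𝔭` is weakly regular in `A_g` for
some `g ∉ 𝔭`** — stated for ANY localisation `Rp` of `A` at `𝔭` as source and EVERY `A`-algebra `Rg` that is a
localisation away from `g` as target (so that it applies verbatim to `𝒪_{X,x}` and `Γ(X, D(g))` on an affine open of a
locally Noetherian scheme). This is the commutative algebra of spreading the regular sequence of EGA IV 17.12.1 /
Matsumura 14.2 from the local ring to an affine neighbourhood, as the tree's `IsRegularImmersionOfCodim` (Görtz–Wedhorn
Def. 19.19) requires. [cite: EGAIV4, Prop. 17.12.1] [cite: GortzWedhorn2023, Def. 19.19] [cite: Matsumura1987, §16] -/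
theorem exists_isWeaklyRegular_isLocalization_away {B : Type u} [CommRing B] [IsNoetherianRing B] (p : Ideal B)
    [p.IsPrime] (Rp : Type*) [CommRing Rp] [Algebra B Rp] [IsLocalization.AtPrime Rp p] (rs : List B)
    (h : IsWeaklyRegular Rp (rs.map (algebraMap B Rp))) :
    ∃ g ∉ p, ∀ (Rg : Type u) [CommRing Rg] [Algebra B Rg] [IsLocalization.Away g Rg],
      IsWeaklyRegular Rg (rs.map (algebraMap B Rg)) := by
  have hA : IsWeaklyRegular Rp rs := (isWeaklyRegular_map_algebraMap_iff Rp Rp rs).1 h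
  let e : Rp ≃ₗ[B] LocalizedModule p.primeCompl B :=
    IsLocalizedModule.linearEquiv p.primeCompl (Algebra.linearMap B Rp) (LocalizedModule.mkLinearMap p.primeCompl B)
  have h' : IsWeaklyRegular (LocalizedModule p.primeCompl B) rs := (e.isWeaklyRegular_congr rs).1 hA
  obtain ⟨g, hgp, hg⟩ := isWeaklyRegular_localizedModule_of_dvd rs p h'
  refine ⟨g, hgp, fun Rg _ _ _ => ?_⟩
  let e' : LocalizedModule (Submonoid.powers g) B ≃ₗ[B] Rg :=
    IsLocalizedModule.linearEquiv (Submonoid.powers g) (LocalizedModule.mkLinearMap (Submonoid.powers g) B)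
      (Algebra.linearMap B Rg)
  exact (isWeaklyRegular_map_algebraMap_iff Rg Rg rs).2
    ((e'.isWeaklyRegular_congr rs).1 (hg _ g (Submonoid.mem_powers g) dvd_rfl))

end Ring

/-! ## Ring form with generation of the ideal (the full algebraic content of the spreading step) -/

section RingDvd

universe u

open RingTheory.Sequence

/-- **Ring form, multiples allowed**: `rs` weakly regular in a localisation `Rp` of a Noetherian `A` at `𝔭` ⟹ there is
`g ∉ 𝔭` such that `rs` is weakly regular in every localisation of `A` away from any MULTIPLE `g'` of `g` (the form that
survives shrinking `D(g)` to `D(g g'')`). [cite: EGAIV4, Prop. 17.12.1] [cite: Matsumura1987, §16] -/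
theorem exists_isWeaklyRegular_isLocalization_away_of_dvd {B : Type u} [CommRing B] [IsNoetherianRing B]
    (p : Ideal B) [p.IsPrime] (Rp : Type*) [CommRing Rp] [Algebra B Rp] [IsLocalization.AtPrime Rp p]
    (rs : List B) (h : IsWeaklyRegular Rp (rs.map (algebraMap B Rp))) :
    ∃ g ∉ p, ∀ g' : B, g ∣ g' → ∀ (Rg : Type u) [CommRing Rg] [Algebra B Rg] [IsLocalization.Away g' Rg],
      IsWeaklyRegular Rg (rs.map (algebraMap B Rg)) := by
  have hA : IsWeaklyRegular Rp rs := (isWeaklyRegular_map_algebraMap_iff Rp Rp rs).1 h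
  let e : Rp ≃ₗ[B] LocalizedModule p.primeCompl B :=
    IsLocalizedModule.linearEquiv p.primeCompl (Algebra.linearMap B Rp) (LocalizedModule.mkLinearMap p.primeCompl B)
  have h' : IsWeaklyRegular (LocalizedModule p.primeCompl B) rs := (e.isWeaklyRegular_congr rs).1 hA
  obtain ⟨g, hgp, hg⟩ := isWeaklyRegular_localizedModule_of_dvd rs p h'
  refine ⟨g, hgp, fun g' hgg' Rg _ _ _ => ?_⟩
  let e' : LocalizedModule (Submonoid.powers g') B ≃ₗ[B] Rg :=
    IsLocalizedModule.linearEquiv (Submonoid.powers g') (LocalizedModule.mkLinearMap (Submonoid.powers g') B)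
      (Algebra.linearMap B Rg)
  exact (isWeaklyRegular_map_algebraMap_iff Rg Rg rs).2
    ((e'.isWeaklyRegular_congr rs).1 (hg _ g' (Submonoid.mem_powers g') hgg'))

/-- **Spreading a regular generating sequence of an ideal from `A_𝔭` to `A_g`.** Let `A` be Noetherian, `𝔭` prime,
`J` an ideal and `rs` a list of elements of `J` whose images in a localisation `Rp` of `A` at `𝔭` form a weakly regular
sequence GENERATING `J·Rp`. Then for some `g ∉ 𝔭` and every multiple `g'` of `g`, in every localisation `Rg` of `A`
away from `g'` the images of `rs` form a weakly regular sequence generating `J·Rg` (regularity: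
`exists_isWeaklyRegular_isLocalization_away_of_dvd`; generation: each of the finitely many generators `m` of `J` has
`t·m ∈ (rs)` for some `t ∉ 𝔭`, and `t` becomes a unit away from `g = g_reg · ∏ t`). With `A = Γ(X, U)`,
`Rp = 𝒪_{X,x}`, `Rg = Γ(X, D(g'))` this is the passage from the stalk to an affine neighbourhood in the definition of
a regular immersion of codimension `p` (Görtz–Wedhorn Def. 19.19). [cite: EGAIV4, Prop. 17.12.1]
[cite: GortzWedhorn2023, Def. 19.19] [cite: Matsumura1987, §16] -/
theorem exists_isWeaklyRegular_and_map_eq_isLocalization_away {B : Type u} [CommRing B] [IsNoetherianRing B]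
    (p : Ideal B) [p.IsPrime] (Rp : Type*) [CommRing Rp] [Algebra B Rp] [IsLocalization.AtPrime Rp p]
    (J : Ideal B) (rs : List B) (hrsJ : ∀ r ∈ rs, r ∈ J)
    (hreg : IsWeaklyRegular Rp (rs.map (algebraMap B Rp)))
    (hgen : J.map (algebraMap B Rp) ≤ (Ideal.ofList rs).map (algebraMap B Rp)) :
    ∃ g ∉ p, ∀ g' : B, g ∣ g' → ∀ (Rg : Type u) [CommRing Rg] [Algebra B Rg] [IsLocalization.Away g' Rg],
      IsWeaklyRegular Rg (rs.map (algebraMap B Rg)) ∧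
        J.map (algebraMap B Rg) = (Ideal.ofList rs).map (algebraMap B Rg) := by
  classical
  obtain ⟨g₁, hg₁p, hg₁⟩ := exists_isWeaklyRegular_isLocalization_away_of_dvd p Rp rs hreg
  -- generation: every generator of `J` is, after multiplying by some `t ∉ p`, in `(rs)`
  obtain ⟨T, hT⟩ := (IsNoetherian.noetherian J : J.FG)
  have key : ∀ m ∈ T, ∃ t ∈ p.primeCompl, t * m ∈ Ideal.ofList rs := by
    intro m hmT
    have hmJ : m ∈ J := hT ▸ Ideal.subset_span hmT
    have hm : algebraMap B Rp m ∈ (Ideal.ofList rs).map (algebraMap B Rp) := hgen (Ideal.mem_map_of_mem _ hmJ)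
    obtain ⟨⟨⟨y, hy⟩, s⟩, hys⟩ := (IsLocalization.mem_map_algebraMap_iff p.primeCompl Rp).1 hm
    -- `hys : algebraMap m * algebraMap s = algebraMap y`
    have heq : algebraMap B Rp (m * s) = algebraMap B Rp y := by
      rw [map_mul]; exact hys
    obtain ⟨c, hc⟩ := (IsLocalization.eq_iff_exists p.primeCompl Rp).1 heq
    refine ⟨c * s, Submonoid.mul_mem _ c.2 s.2, ?_⟩
    have : (c : B) * (s : B) * m = c * y := by rw [mul_assoc, mul_comm (s : B) m]; exact hc
    rw [this]
    exact Ideal.mul_mem_left _ _ hy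
  choose! t htp htm using key
  refine ⟨g₁ * ∏ m ∈ T, t m, fun hmem => (Ideal.IsPrime.mem_or_mem ‹p.IsPrime› hmem).elim hg₁p
    (fun h => ?_), fun g' hgg' Rg _ _ _ => ⟨hg₁ g' (dvd_trans (dvd_mul_right _ _) hgg') Rg, ?_⟩⟩
  · obtain ⟨m, hmT, hm⟩ := (Ideal.IsPrime.prod_mem_iff (p := p)).1 h
    exact htp m hmT hm
  · apply le_antisymm
    · rw [← hT, Ideal.map_span, Ideal.span_le]
      rintro _ ⟨m, hmT, rfl⟩
      have hu : IsUnit (algebraMap B Rg (t m)) :=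
        IsLocalization.Away.isUnit_of_dvd (x := g')
          (dvd_trans (dvd_trans (Finset.dvd_prod_of_mem t hmT) (dvd_mul_left _ g₁)) hgg')
      obtain ⟨v, hv⟩ := hu.exists_left_inv
      have hmem : algebraMap B Rg (t m * m) ∈ (Ideal.ofList rs).map (algebraMap B Rg) :=
        Ideal.mem_map_of_mem _ (htm m hmT)
      have : algebraMap B Rg m = v * algebraMap B Rg (t m * m) := by
        rw [map_mul, ← mul_assoc, hv, one_mul]
      rw [SetLike.mem_coe, this]
      exact Ideal.mul_mem_left _ v hmem
    · exact Ideal.map_mono ((Ideal.span_le).2 fun r hr => hrsJ r hr)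

end RingDvd


end Summit.HodgeConjecture.HodgeConjecture.Theorems
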